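import Mathlib
import Summits.Ventures.HodgeRepro.Tier4.Line4.SublevelCount
import Summits.Ventures.HodgeRepro.Tier4.Line4.ArchDistBounds
import Summits.Ventures.HodgeRepro.Tier4.Line4.FinitePlacePositivity
import Summits.Ventures.HodgeRepro.Tier4.Line4.TorusProduct

/-!
# Tier4/Line4/SublevelCountBase — the sublevel count at the identity implies the sublevel count on every compact pair

Blind re-derivation cell `pub-hodge-repro`, Tier 4 «prove the step» (README §9–§10), seat t4-L4-p2 (prover, LINE L4,
gen 4; C-L4-SUBLEVEL, the reduction of display (8)).  Tree path
`lean/Summits/Ventures/HodgeRepro/Tier4/Line4/SublevelCountBase.lean`.  One `def … : Prop` (the smaller display) and one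
theorem; no literature.

`SublevelCount W S` (display (8)) asks the sublevel lattice count `#{γ : (x⁻¹ γ y)_f ∈ Kf, archDist (x⁻¹ γ y) ≤ T} ≤ C′ e^{αT}`
UNIFORMLY for `x`, `y` in compacts.  `SublevelCount₀ W S` asks it at `x = y = 1` only — the classical «rational points of
`U(W)` in a ball of radius `T` at the infinite places, with finite part in a compact» count.  The two are equivalent for
the line (`sublevelCount_of_sublevelCount₀`): `(x⁻¹ γ y)_f ∈ Kf` puts `γ_f` in the compact `(C₁)_f · Kf · (C₂)_f⁻¹`
(`ofFinPart` is a continuous homomorphism, `FinitePlacePositivity`), and `archDist (x⁻¹ γ y) ≤ T` gives `archDist γ ≤ T + c`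
with `c = c(C₁, C₂)` (`ArchDistBounds.archDist_le_conj_add`); the constant becomes `C′ e^{αc}`, the exponent is unchanged.
So display (8) may be stated as `SublevelCount₀` — no compact pair, one explicit set per radius.

Nothing here says anything about the status of the Hodge conjecture for CM abelian varieties, which is NOT proved
(HC_CM is NOT proved by anyone in this repository).
-/

set_option autoImplicit false

noncomputable section

namespace Summit.Ventures.HodgeRepro.Tier4.Line4

open Summit.Ventures.HodgeRepro.Tier4.Common Summit.Ventures.HodgeRepro.Tier4.Line1
  Summit.Ventures.HodgeRepro.Tier4.Line1.RTF Summit.Ventures.HodgeRepro.Tier4.Line4.L1Class MeasureTheory NumberField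

open scoped Pointwise

variable {k : Type} [Field k] [NumberField k] (W : PlaneData k) [MeasurableSpace (GA W)] [BorelSpace (GA W)]

omit [BorelSpace (GA W)] in
/-- **DISPLAY — the sublevel lattice count at the identity**: on every compact `Kf ⊆ G(𝔸_f)`, the rational points `γ` with
`γ_f ∈ Kf` and `archDist γ ≤ T` lie in a finite set of at most `C′ e^{αT}` elements, `α < 3`. -/
def SublevelCount₀ (S : RTF.Setting (GA W)) : Prop :=
  ∀ Kf : Set (GA W), IsCompact Kf → Kf ⊆ (finitePart W : Set (GA W)) →
    ∃ C' α : ℝ, 0 ≤ C' ∧ α < 3 ∧ ∀ T : ℝ, ∃ s : Finset S.Gk,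
      (∀ γ : S.Gk, GA.ofFinPart W (γ : GA W) ∈ Kf → archDist W (γ : GA W) ≤ T → γ ∈ s) ∧
      (s.card : ℝ) ≤ C' * Real.exp (α * T)

omit [BorelSpace (GA W)] in
/-- **The count at the identity gives the count on every compact pair**: `SublevelCount₀ W S → SublevelCount W S`
(finite parts through the continuous homomorphism `ofFinPart`, the archimedean shift through `archDist_le_conj_add`). -/
theorem sublevelCount_of_sublevelCount₀ (S : RTF.Setting (GA W)) (h : SublevelCount₀ W S) : SublevelCount W S := by
  intro Kf hKf hKfin C₁ C₂ hC₁ hC₂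
  -- the finite parts of the compacts
  have hF₁ : IsCompact (GA.ofFinPart W '' C₁) := hC₁.image (continuous_ofFinPart W)
  have hF₂ : IsCompact (GA.ofFinPart W '' C₂) := hC₂.image (continuous_ofFinPart W)
  -- the enlarged compact of the finite part
  set Kf' : Set (GA W) := (GA.ofFinPart W '' C₁) * Kf * (GA.ofFinPart W '' C₂)⁻¹ with hKf'
  have hKf'c : IsCompact Kf' := (hF₁.mul hKf).mul hF₂.inv
  have hKf'fin : Kf' ⊆ (finitePart W : Set (GA W)) := by
    rintro _ ⟨_, ⟨_, ⟨x, _, rfl⟩, z, hz, rfl⟩, _, hy, rfl⟩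
    refine Subgroup.mul_mem _ (Subgroup.mul_mem _ (ofFinPart_mem_finitePart W x) (hKfin hz)) ?_
    rw [Set.mem_inv] at hy
    exact (Subgroup.inv_mem_iff _).mp (by
      obtain ⟨y, _, hyy⟩ := hy
      rw [← hyy]
      exact ofFinPart_mem_finitePart W y)
  -- the archimedean shift
  obtain ⟨c, hc⟩ := archDist_le_conj_add W C₁ C₂ hC₁ hC₂
  obtain ⟨C', α, hC'0, hα, hcount⟩ := h Kf' hKf'c hKf'fin
  refine ⟨C' * Real.exp (α * c), α, by positivity, hα, fun x hx y hy T => ?_⟩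
  obtain ⟨s, hs, hcard⟩ := hcount (T + c)
  refine ⟨s, fun γ hγf hγd => hs γ ?_ ?_, ?_⟩
  · -- `γ_f = x_f · (x⁻¹ γ y)_f · y_f⁻¹ ∈ Kf'`
    have heq : GA.ofFinPart W (γ : GA W) =
        GA.ofFinPart W x * GA.ofFinPart W (x⁻¹ * γ * y) * (GA.ofFinPart W y)⁻¹ := by
      rw [ofFinPart_mul, ofFinPart_mul, ofFinPart_inv]
      group
    rw [heq]
    refine Set.mul_mem_mul (Set.mul_mem_mul ⟨x, hx, rfl⟩ hγf) ?_
    rw [Set.mem_inv, inv_inv]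
    exact ⟨y, hy, rfl⟩
  · exact (hc x hx y hy γ).trans (by linarith)
  · calc (s.card : ℝ) ≤ C' * Real.exp (α * (T + c)) := hcard
      _ = C' * Real.exp (α * c) * Real.exp (α * T) := by
        rw [mul_add, Real.exp_add]
        ring

end Summit.Ventures.HodgeRepro.Tier4.Line4

end
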